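import Mathlib
import HarnessLib
import Literature.Analysis.FluidPDE.SelfSimilar
import Literature.Analysis.FluidPDE.VectorCalculus
import Literature.Analysis.FluidPDE.VorticityCalculus
import Literature.Analysis.FluidPDE.NSBoundedMildOseen
import Literature.Analysis.FluidPDE.SuitableWeak
import Literature.Analysis.FluidPDE.WeakSolution
import Literature.Analysis.FluidPDE.LocalTypeI
import Literature.Analysis.UnboundedOperators.HeatKernel
import Summits.NavierStokesRegularity.NavierStokesRegularity.Theorems.LocalSineTubeDoorProfileAlignedWindowRigidityAncient

/-!
# `FilamentPinchDoor.FilamentPinchLiouville` (stmt-NavierStokesRegularity-26430) — line `birth` (skeleton r3),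
# stub `stub_poloidalOfNoTerminalMass` PROVED: a one-signed component with FROZEN windowed circulation that leaves
# NO TERMINAL MASS at the blow-up time was never there

Registered stub of the skeleton of record (lead skeleton r3 of crux 26430: the research stub `stub_pinchExclusion` of
r2 is reshaped into `stub_noTerminalMass` (XL, research: the terminal windowed masses vanish) and THIS stub (S); the
composition `FilamentPinchLiouville_of` is unchanged), VERBATIM.

STATEMENT.  For a profile `v` of the route's class and a direction `e` with `ω_e := ⟪curl v, e⟫ ≥ 0` everywhere,
suppose the windowed Kelvin law holds (for every smooth compactly supported window `φ` there is `K₂` with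
`|Ψ_L(a,t) − Ψ_L(a,s)| ≤ K₂(t−s)/L²` for `s<t<0`, where `Ψ_L(a,τ) = L⁻¹∫ ω_e(τ,y) φ((y−a)/L) dy`; landed as
`stub_frozenFlux`, p623029) and suppose every windowed circulation tends to `0` as `t → 0⁻` (NO TERMINAL MASS).
Then `ω_e ≡ 0` on every slice `s < 0`.

PROOF (backward uniqueness for free, from the sign).  Fix `s<0`, `a`, and the standard bump `φ₁` (`= 1` on `B(0,1)`,
supported in `B(0,2)`, `0 ≤ φ₁ ≤ 1`).  Letting `t → 0⁻` in the Kelvin law gives `|Ψ_L(a,s)| ≤ K₂(−s)/L²`; since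
`ω_e ≥ 0` and `φ₁((·−a)/L) ≥ 𝟙_{B(a,L)}`, `∫_{B(a,L)} ω_e(s) ≤ L·Ψ_L(a,s) ≤ K₂(−s)/L`.  The ball mass is
non-decreasing in `L`, so `∫_{B(a,L₀)} ω_e(s) ≤ K₂(−s)/L → 0` (`L → ∞`): every ball mass vanishes, and a continuous
non-negative function with vanishing ball integrals is zero (slices of the class are real-analytic, tree
`…LocalSineTubeDoorProfileAlignedWindowRigidityAncient.analyticOnNhd_slice`).  CONSEQUENCE for the line: the research
content of crux 26430 is exactly «a backward-singular one-signed Type-I profile of the energy class leaves no terminal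
one-signed vorticity measure» (`stub_noTerminalMass`).

HONEST FRAMING: a structural lemma about HYPOTHETICAL Type-I blow-up profiles; nothing here bears on Navier–Stokes
regularity; no summit statement is proved.
-/

noncomputable section

-- the summit and its single sub-problem share the name (CONVENTIONS §1), as in every Theorems file
set_option linter.dupNamespace false

namespace Summit.NavierStokesRegularity.NavierStokesRegularity.Theorems.FilamentPinchDoorFilamentPinchLiouvilleStubPoloidalOfNoTerminalMass

open Set Function Filter MeasureTheory Metric Topology InnerProductSpace
open scoped ENNReal NNReal RealInnerProductSpace
open Literature.Analysis Literature.Analysis.FluidPDE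
open Summit.NavierStokesRegularity.NavierStokesRegularity.Theorems.LocalSineTubeDoorProfileAlignedWindowRigidityAncient

/-! ### A continuous non-negative function with vanishing ball integrals vanishes -/

/-- If `ω ≥ 0` is continuous and `∫_{B(a,L)} ω = 0` for every ball, then `ω ≡ 0`. [folklore] -/
theorem eq_zero_of_forall_setIntegral_ball_eq_zero {ω : EuclideanSpace ℝ (Fin 3) → ℝ} (hωc : Continuous ω)
    (hω0 : ∀ y, 0 ≤ ω y) (h : ∀ (a : EuclideanSpace ℝ (Fin 3)) (L : ℝ), 0 < L → ∫ y in ball a L, ω y = 0)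
    (y : EuclideanSpace ℝ (Fin 3)) : ω y = 0 := by
  by_contra hne
  have hpos : 0 < ω y := lt_of_le_of_ne (hω0 y) (Ne.symm hne)
  have hi : IntegrableOn ω (ball y 1) :=
    (hωc.continuousOn.integrableOn_compact (isCompact_closedBall y 1)).mono_set ball_subset_closedBall
  have key : 0 < ∫ x in ball y 1, ω x := by
    rw [integral_pos_iff_support_of_nonneg_ae (Eventually.of_forall fun x => hω0 x) hi,
      Measure.restrict_apply' measurableSet_ball]
    exact (hωc.isOpen_support.inter isOpen_ball).measure_pos volume ⟨y, hpos.ne', mem_ball_self one_pos⟩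
  linarith [h y 1 one_pos]

/-! ### Ball masses of a non-negative density under a window bound -/

/-- If `ω ≥ 0` is continuous, `φ ≥ 0` with `φ = 1` on `B̄(0,1)` and compact support, then
`∫_{B(a,L)} ω ≤ ∫ ω(y) φ(L⁻¹(y − a)) dy` for `L > 0`. [folklore] -/
theorem setIntegral_ball_le_integral_mul_window {ω φ : EuclideanSpace ℝ (Fin 3) → ℝ} (hωc : Continuous ω)
    (hω0 : ∀ y, 0 ≤ ω y) (hφc : Continuous φ) (hφs : HasCompactSupport φ) (hφ0 : ∀ z, 0 ≤ φ z)
    (hφ1 : ∀ z, ‖z‖ ≤ 1 → φ z = 1) {L : ℝ} (hL : 0 < L) (a : EuclideanSpace ℝ (Fin 3)) :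
    ∫ y in ball a L, ω y ≤ ∫ y, ω y * φ (L⁻¹ • (y - a)) := by
  rw [← integral_indicator measurableSet_ball]
  -- the right-hand integrand is continuous with compact support
  have hT : Continuous fun y : EuclideanSpace ℝ (Fin 3) => L⁻¹ • (y - a) :=
    (continuous_id.sub continuous_const).const_smul L⁻¹
  have hφL : HasCompactSupport fun y : EuclideanSpace ℝ (Fin 3) => φ (L⁻¹ • (y - a)) := by
    obtain ⟨R, hR, hsupp⟩ := hφs.exists_pos_le_norm
    refine HasCompactSupport.intro (isCompact_closedBall a (R * L)) fun y hy => hsupp _ ?_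
    rw [mem_closedBall, dist_eq_norm, not_le] at hy
    rw [norm_smul, norm_inv, Real.norm_of_nonneg hL.le, le_inv_mul_iff₀' hL]
    exact hy.le
  have hint : Integrable fun y => ω y * φ (L⁻¹ • (y - a)) :=
    (hωc.mul (hφc.comp hT)).integrable_of_hasCompactSupport hφL.mul_left
  refine integral_mono_of_nonneg (Eventually.of_forall fun y => ?_) hint (Eventually.of_forall fun y => ?_)
  · exact indicator_nonneg (fun z _ => hω0 z) y
  · by_cases hy : y ∈ ball a L
    · rw [indicator_of_mem hy]
      show ω y ≤ ω y * φ (L⁻¹ • (y - a))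
      have h1 : φ (L⁻¹ • (y - a)) = 1 := by
        apply hφ1
        rw [mem_ball, dist_eq_norm] at hy
        rw [norm_smul, norm_inv, Real.norm_of_nonneg hL.le, inv_mul_le_iff₀ hL]
        linarith
      rw [h1, mul_one]
    · rw [indicator_of_notMem hy]
      exact mul_nonneg (hω0 y) (hφ0 _)

/-! ### The registered stub -/

/-- **Stub `stub_poloidalOfNoTerminalMass` of line `birth` (skeleton r3, crux `FilamentPinchLiouville`, stmt-26430),
VERBATIM**: for a profile of the route's class with `⟪curl v, e⟫ ≥ 0`, the windowed Kelvin law and NO TERMINAL MASS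
(every scale-normalised windowed circulation tends to `0` as `t → 0⁻`) force `⟪curl v(s), e⟫ ≡ 0` for every `s < 0`
(letting `t → 0⁻` in the Kelvin law bounds the ball masses by `K₂(−s)/L → 0` as `L → ∞`). [folklore] -/
theorem stub_poloidalOfNoTerminalMass : ∀ (C : ℝ) (v : ℝ → EuclideanSpace ℝ (Fin 3) → EuclideanSpace ℝ (Fin 3)) (π : ℝ → EuclideanSpace ℝ (Fin 3) → ℝ) (H : ℝ → EuclideanSpace ℝ (Fin 3) → EuclideanSpace ℝ (Fin 3) →L[ℝ] EuclideanSpace ℝ (Fin 3)), Literature.Analysis.FluidPDE.HasTypeITimeDecay C v → ContinuousOn (Function.uncurry v) (Set.Iio (0 : ℝ) ×ˢ Set.univ) → (∀ s t : ℝ, s < t → t < 0 → ∀ x, v t x = Literature.Analysis.UnboundedOperators.heatExtension (v s) (t - s) x - Literature.Analysis.FluidPDE.oseenDuhamel 1 s v v t x) → (∀ t < 0, Literature.Analysis.FluidPDE.VectorCalculus.IsDivFree (v t)) → Literature.Analysis.FluidPDE.IsSuitableWeakSolutionOn (Literature.Analysis.FluidPDE.slab (EuclideanSpace ℝ (Fin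 3)) (Set.Iio (0 : ℝ)) isOpen_Iio) 1 0 v π → Literature.Analysis.FluidPDE.HasWeakSpatialGradientOn (Literature.Analysis.FluidPDE.slab (EuclideanSpace ℝ (Fin 3)) (Set.Iio (0 : ℝ)) isOpen_Iio) v H → Literature.Analysis.FluidPDE.typeIBound (Set.Iio (0 : ℝ) ×ˢ Set.univ) v π H < ⊤ → ∀ (e : EuclideanSpace ℝ (Fin 3)), e ≠ 0 → (∀ s < 0, ∀ y, 0 ≤ ⟪Literature.Analysis.FluidPDE.curl (v s) y, e⟫_ℝ) → (∃ K : ℝ, ∀ s < 0, ∀ (x : EuclideanSpace ℝ (Fin 3)) (R : ℝ), 0 < R → ∫⁻ y in Metric.ball x R, ENNReal.ofReal ⟪Literature.Analysis.FluidPDE.curl (v s) y, e⟫_ℝ ≤ ENNReal.ofReal (K * R)) → (∀ (φ : EuclideanSpace ℝ (Fin 3) → ℝ), ContDiff ℝ (⊤ : ℕ∞) φ → HasCompactSupport φ → ∃ K₂ : ℝ, ∀ L : ℝ, 0 < L → ∀ (a : EuclideanSpace ℝ (Fin 3)) (s t : ℝ), s < t → t < 0 → |(L⁻¹ * ∫ y,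 ⟪Literature.Analysis.FluidPDE.curl (v t) y, e⟫_ℝ * φ (L⁻¹ • (y - a))) - (L⁻¹ * ∫ y, ⟪Literature.Analysis.FluidPDE.curl (v s) y, e⟫_ℝ * φ (L⁻¹ • (y - a)))| ≤ K₂ * (t - s) / L ^ 2) → (∀ (φ : EuclideanSpace ℝ (Fin 3) → ℝ), ContDiff ℝ (⊤ : ℕ∞) φ → HasCompactSupport φ → ∀ (a : EuclideanSpace ℝ (Fin 3)) (L : ℝ), 0 < L → Filter.Tendsto (fun t : ℝ => L⁻¹ * ∫ y, ⟪Literature.Analysis.FluidPDE.curl (v t) y, e⟫_ℝ * φ (L⁻¹ • (y - a))) (nhdsWithin (0 : ℝ) (Set.Iio 0)) (nhds 0)) → ∀ s < 0, ∀ y, ⟪Literature.Analysis.FluidPDE.curl (v s) y, e⟫_ℝ = 0 := by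
  intro C v π H hrate hcont hmild _ _ _ _ e _ hnn _ hFF hTV s hs
  -- the standard bump
  let φ₁ : ContDiffBump (0 : EuclideanSpace ℝ (Fin 3)) := ⟨1, 2, one_pos, one_lt_two⟩
  have hφs : ContDiff ℝ (⊤ : ℕ∞) φ₁ := φ₁.contDiff
  have hφc : HasCompactSupport φ₁ := φ₁.hasCompactSupport
  have hφ0 : ∀ z, 0 ≤ (φ₁ : EuclideanSpace ℝ (Fin 3) → ℝ) z := fun z => φ₁.nonneg
  have hφ1 : ∀ z : EuclideanSpace ℝ (Fin 3), ‖z‖ ≤ 1 → φ₁ z = 1 := fun z hz =>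
    φ₁.one_of_mem_closedBall (by simpa using hz)
  obtain ⟨K₂, hK₂⟩ := hFF φ₁ hφs hφc
  -- the slice `ω_e(s, ·)` is continuous and non-negative
  have hw : ContDiff ℝ 1 (v s) :=
    (analyticOnNhd_slice hcont (bdd_of_hasTypeITimeDecay hrate) hmild hs).contDiff
  have hωc : Continuous fun y => ⟪curl (v s) y, e⟫ := (continuous_curl hw).inner continuous_const
  -- Step 1: every ball mass is at most `K₂(−s)/L`
  have step1 : ∀ (a : EuclideanSpace ℝ (Fin 3)) (L : ℝ), 0 < L →
      ∫ y in ball a L, ⟪curl (v s) y, e⟫ ≤ K₂ * (-s) / L := by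
    intro a L hL
    set Ψ : ℝ → ℝ := fun t => L⁻¹ * ∫ y, ⟪curl (v t) y, e⟫ * φ₁ (L⁻¹ • (y - a)) with hΨdef
    have hlim : Tendsto Ψ (𝓝[<] (0 : ℝ)) (𝓝 0) := hTV φ₁ hφs hφc a L hL
    -- pass to the limit `t → 0⁻` in the Kelvin law
    have h1 : Tendsto (fun t => |Ψ t - Ψ s|) (𝓝[<] (0 : ℝ)) (𝓝 |0 - Ψ s|) :=
      (hlim.sub_const (Ψ s)).abs
    have h2 : Tendsto (fun t : ℝ => K₂ * (t - s) / L ^ 2) (𝓝[<] (0 : ℝ)) (𝓝 (K₂ * (0 - s) / L ^ 2)) := by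
      have ht : Tendsto (fun t : ℝ => t) (𝓝[<] (0 : ℝ)) (𝓝 0) := tendsto_nhdsWithin_of_tendsto_nhds tendsto_id
      exact ((ht.sub_const s).const_mul K₂).div_const (L ^ 2)
    have h3 : ∀ᶠ t in 𝓝[<] (0 : ℝ), |Ψ t - Ψ s| ≤ K₂ * (t - s) / L ^ 2 := by
      filter_upwards [Ioo_mem_nhdsLT hs] with t ht
      exact hK₂ L hL a s t ht.1 ht.2
    have hbd : |0 - Ψ s| ≤ K₂ * (0 - s) / L ^ 2 := le_of_tendsto_of_tendsto h1 h2 h3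
    have hΨ : Ψ s ≤ K₂ * (-s) / L ^ 2 := by
      rw [zero_sub, abs_neg, zero_sub] at hbd
      exact (le_abs_self _).trans hbd
    have hlow : ∫ y in ball a L, ⟪curl (v s) y, e⟫ ≤ ∫ y, ⟪curl (v s) y, e⟫ * φ₁ (L⁻¹ • (y - a)) :=
      setIntegral_ball_le_integral_mul_window hωc (hnn s hs) φ₁.continuous hφc hφ0 hφ1 hL a
    have hmul : ∫ y, ⟪curl (v s) y, e⟫ * φ₁ (L⁻¹ • (y - a)) = L * Ψ s := by
      rw [hΨdef]
      field_simp
    calc ∫ y in ball a L, ⟪curl (v s) y, e⟫ ≤ L * Ψ s := hlow.trans hmul.le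
      _ ≤ L * (K₂ * (-s) / L ^ 2) := mul_le_mul_of_nonneg_left hΨ hL.le
      _ = K₂ * (-s) / L := by field_simp
  -- Step 2: every ball mass vanishes (monotone in the radius, bound → 0)
  have step2 : ∀ (a : EuclideanSpace ℝ (Fin 3)) (L₀ : ℝ), 0 < L₀ →
      ∫ y in ball a L₀, ⟪curl (v s) y, e⟫ = 0 := by
    intro a L₀ hL₀
    have hnn' : 0 ≤ ∫ y in ball a L₀, ⟪curl (v s) y, e⟫ :=
      setIntegral_nonneg measurableSet_ball fun y _ => hnn s hs y
    have hle : ∀ L, L₀ ≤ L → ∫ y in ball a L₀, ⟪curl (v s) y, e⟫ ≤ K₂ * (-s) / L := by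
      intro L hL
      have hLpos : 0 < L := hL₀.trans_le hL
      have hi : IntegrableOn (fun y => ⟪curl (v s) y, e⟫) (ball a L) :=
        (hωc.continuousOn.integrableOn_compact (isCompact_closedBall a L)).mono_set ball_subset_closedBall
      exact (setIntegral_mono_set hi (Eventually.of_forall fun y => hnn s hs y)
        (Eventually.of_forall (ball_subset_ball hL))).trans (step1 a L hLpos)
    have hlim : Tendsto (fun L : ℝ => K₂ * (-s) / L) atTop (𝓝 0) :=
      tendsto_const_nhds.div_atTop tendsto_id
    exact le_antisymm (ge_of_tendsto hlim (eventually_atTop.2 ⟨L₀, hle⟩)) hnn'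
  -- Step 3: a continuous non-negative function with vanishing ball integrals vanishes
  exact eq_zero_of_forall_setIntegral_ball_eq_zero hωc (hnn s hs) step2

end Summit.NavierStokesRegularity.NavierStokesRegularity.Theorems.FilamentPinchDoorFilamentPinchLiouvilleStubPoloidalOfNoTerminalMass

end
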